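import Summits.QuantumFields.YangMills.Theorems.LuscherReductionTwistedTraceScalingBOCentralTube
import Summits.QuantumFields.YangMills.Theorems.LuscherReductionTwistedTraceScalingBTColourInvariance
import Summits.QuantumFields.YangMills.Theorems.LuscherReductionTwistedTraceScalingBTCoreWeight
import HarnessLib

/-!
# (C1c'-α) THE LOCALISED GAUGE AVERAGE IS `Z` TIMES A CORE-RESTRICTED GAUGE AVERAGE: `A_W(f)(V) = Z·∫ 𝟙_S(g)·f(V^{g⁻¹}) dg` (Faddeev–Popov for the global colour), and its sandwich by `gaugeAvg f`
# (lane A of S-BASE, crux `TwistedTraceScaling` stmt-QuantumFields-20203, C4-CORE, the (OD) pen, step (1) of the (C1c') plan of `pub/ym-fleet/ym-luscher-20007-p1/HANDOFF-g17.md`)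

After `…BOCentralTube.central_transfer_two_sided_of_localisedAvg(_local)` the only analytic input of (C1) is the two-sided Gaussian shape of the `W`-localised gauge average
`A_W(f)(V) = ∫_g W(g)·f(V^{g⁻¹}) dg` of the BO function `f = boFun χ₀ Ω`.  For the weights of record `W = S.indicator W₀` (`W₀ = fpWeight ε` with constant colour-orbit integral `Z = fpZ ε`,
`S = coreSet R₁`; `…BTCoreWeight`) this file removes `W`:
* §1 `boFun_conj` — a BO function with a class-function amplitude and a colour-blind profile is invariant under global colour rotations (`slowMean_conj`, `relLinkVec_conj`, `conj_mem_orthoTubeSet_iff`);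
* §2 `localisedAvg_conj` — for a conjugation-invariant weight and a colour-invariant `f`, `A_W(f)(cVc⁻¹) = A_W(f)(V)` (`g ↦ cgc⁻¹` in the gauge-group Haar measure);
* §3 ★★★ `localisedAvg_eq_const_mul_core` — if `∫_c W₀(c·g) dc = Z` for every `g` (`…BTColourFP.integral_gaugeMeasure_fp`), `S` is invariant under left colour multiplication, `W = S.indicator W₀` is
  conjugation invariant and `f` is colour invariant, then `A_W(f)(V) = Z·∫ 𝟙_S(g)·f(V^{g⁻¹}) dg`;
* §4 ★★ `localisedAvg_le_const_mul_gaugeAvg` / ★★ `const_mul_gaugeAvg_sub_le_localisedAvg` — for `f ≥ 0`: `A_W(f)(V) ≤ Z·gaugeAvg f V` and `Z·(gaugeAvg f V − ∫ 𝟙_{Sᶜ}(g) f(V^{g⁻¹}) dg) ≤ A_W(f)(V)`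
  (inversion invariance of the gauge-group Haar measure); ★★ `localisedAvg_coreWeight` — the instance `W = coreWeight ε R₁`, `Z = fpZ`-type constant supplied as the hypothesis `hZ` on `fpWeight ε`.
So (C1c') = two-sided Gaussian shape of the FULL gauge average `gaugeAvg (boFun χ₀ Ω_G)` on the chart ball (steps (2)–(4) of the plan: rider sandwich against `N = gaugeAvg recordChi`, (P)
`fpWeight_core_constant_pow`, slice geometry) + smallness of the core-complement part (step (5)).
HONEST FRAMING: symmetry bookkeeping for a stub of a child of the CONDITIONAL route R2b1; (C1c') steps (2)–(5), (C4), (C5), (B-ST) OPEN; C4-CORE OPEN; not infinite volume, not a gap, not Clay.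
-/

set_option autoImplicit false

noncomputable section

open MeasureTheory Filter Topology Real
open scoped BigOperators
open Literature.MathematicalPhysics.QuantumFieldTheory
open Literature.MathematicalPhysics.QuantumLattice

namespace Summit.QuantumFields.YangMills.Theorems.FemtoTransferGap.TwoLattice.ConstTube

open Summit.QuantumFields.YangMills.Theorems.FemtoTransferGap
open Summit.QuantumFields.YangMills.Theorems.FemtoTransferGap.TwoLattice
open Summit.QuantumFields.YangMills.Theorems.FemtoTransferGap.TwoLattice.Avg
open Summit.QuantumFields.YangMills.Theorems.FemtoTransferGap.TwoLattice.Stiff (LinkSpace)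

variable {L : ℕ} [NeZero L]

/-! ## §1 Colour invariance of BO functions -/

/-- ★ A BO function with a class-function amplitude `φ(cuc⁻¹) = φ(u)` and a colour-blind profile `Ω(Ad_c x) = Ω(x)` is invariant under global colour rotations: `boFun φ Ω (cUc⁻¹) = boFun φ Ω U`.
[folklore] -/
theorem boFun_conj {φ : GaugeConfig 3 1 SU2 → ℝ} (hφ : ∀ (c : SU2) (u : GaugeConfig 3 1 SU2), φ (gaugeTransform (fun _ : Site 3 1 => c) u) = φ u) {Ω : LinkSpace L → ℝ}
    (hΩ : ∀ (c : SU2) (x : LinkSpace L), Ω (adL L c x) = Ω x) (c : SU2) (U : GaugeConfig 3 L SU2) :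
    boFun L φ Ω (gaugeTransform (fun _ : Site 3 L => c) U) = boFun L φ Ω U := by
  unfold boFun
  by_cases hU : U ∈ orthoTubeSet L
  · rw [Set.indicator_of_mem hU, Set.indicator_of_mem ((conj_mem_orthoTubeSet_iff L c U).2 hU), slowMean_conj, relLinkVec_conj, hφ, hΩ]
  · rw [Set.indicator_of_notMem hU, Set.indicator_of_notMem (fun h => hU ((conj_mem_orthoTubeSet_iff L c U).1 h)), zero_mul, zero_mul]

/-! ## §2 The localised average is colour invariant -/

omit [NeZero L] in
/-- Pointwise: `(c·g·c⁻¹)⁻¹ · (cVc⁻¹) = c·(g⁻¹·V)·c⁻¹` — inverting a conjugated gauge transformation. [folklore] -/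
theorem gaugeTransform_conj_inv_gaugeTransform_const (c : SU2) (g : Site 3 L → SU2) (V : GaugeConfig 3 L SU2) :
    gaugeTransform (fun x => c * g x * c⁻¹)⁻¹ (gaugeTransform (fun _ : Site 3 L => c) V) = gaugeTransform (fun _ : Site 3 L => c) (gaugeTransform g⁻¹ V) := by
  have h : (fun x => c * g x * c⁻¹)⁻¹ = fun x => c * g⁻¹ x * c⁻¹ := by
    funext x; simp only [Pi.inv_apply, mul_inv_rev, inv_inv, mul_assoc]
  rw [h]
  exact gaugeTransform_conj_gaugeTransform_const c g⁻¹ V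

/-- ★ **Colour invariance of the localised average**: for a conjugation-invariant bounded measurable weight `W` and a colour-invariant `f`,
`A_W(f)(cVc⁻¹) = A_W(f)(V)`. [folklore] -/
theorem localisedAvg_conj {W : (Site 3 L → SU2) → ℝ} (hWinv : ∀ (c : SU2) (g : Site 3 L → SU2), W (fun x => c * g x * c⁻¹) = W g)
    {f : GaugeConfig 3 L SU2 → ℝ} (hf : ∀ (c : SU2) (U : GaugeConfig 3 L SU2), f (gaugeTransform (fun _ : Site 3 L => c) U) = f U) (c : SU2) (V : GaugeConfig 3 L SU2) :
    ∫ g, W g * f (gaugeTransform g⁻¹ (gaugeTransform (fun _ : Site 3 L => c) V)) ∂gaugeMeasure L = ∫ g, W g * f (gaugeTransform g⁻¹ V) ∂gaugeMeasure L := by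
  haveI : SecondCountableTopology SU2 := secondCountableTopology_su2
  -- `g ↦ c g c⁻¹`
  have h1 : ∫ g, W g * f (gaugeTransform g⁻¹ (gaugeTransform (fun _ : Site 3 L => c) V)) ∂gaugeMeasure L =
      ∫ g, W ((fun _ : Site 3 L => c) * g) * f (gaugeTransform ((fun _ : Site 3 L => c) * g)⁻¹ (gaugeTransform (fun _ : Site 3 L => c) V)) ∂gaugeMeasure L :=
    (integral_mul_left_eq_self (μ := gaugeMeasure L) (fun g : Site 3 L → SU2 => W g * f (gaugeTransform g⁻¹ (gaugeTransform (fun _ : Site 3 L => c) V))) (fun _ => c)).symm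
  have h2 : ∫ g, W ((fun _ : Site 3 L => c) * g) * f (gaugeTransform ((fun _ : Site 3 L => c) * g)⁻¹ (gaugeTransform (fun _ : Site 3 L => c) V)) ∂gaugeMeasure L =
      ∫ g, W ((fun _ : Site 3 L => c) * (g * fun _ : Site 3 L => c⁻¹)) * f (gaugeTransform ((fun _ : Site 3 L => c) * (g * fun _ : Site 3 L => c⁻¹))⁻¹ (gaugeTransform (fun _ : Site 3 L => c) V))
        ∂gaugeMeasure L :=
    (integral_mul_right_eq_self (μ := gaugeMeasure L) (fun g : Site 3 L → SU2 => W ((fun _ : Site 3 L => c) * g) *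
      f (gaugeTransform ((fun _ : Site 3 L => c) * g)⁻¹ (gaugeTransform (fun _ : Site 3 L => c) V))) (fun _ => c⁻¹)).symm
  rw [h1, h2]
  refine integral_congr_ae (ae_of_all _ fun g => ?_)
  dsimp only
  have e : ((fun _ : Site 3 L => c) * (g * fun _ : Site 3 L => c⁻¹)) = fun x => c * g x * c⁻¹ := by funext x; simp [Pi.mul_apply, mul_assoc]
  rw [e, hWinv, gaugeTransform_conj_inv_gaugeTransform_const, hf]

/-! ## §3 ★★★ Faddeev–Popov for the global colour in the localised average -/

omit [NeZero L] in
/-- Pointwise: `(c·g)⁻¹ · V = g⁻¹ · (c⁻¹ V c)`. [folklore] -/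
theorem gaugeTransform_constMul_inv (c : SU2) (g : Site 3 L → SU2) (V : GaugeConfig 3 L SU2) :
    gaugeTransform (fun x => c * g x)⁻¹ V = gaugeTransform g⁻¹ (gaugeTransform (fun _ : Site 3 L => c⁻¹) V) := by
  rw [gaugeTransform_gaugeTransform]
  congr 1
  funext x; simp only [Pi.inv_apply, Pi.mul_apply, mul_inv_rev]

/-- ★★★ **`A_W(f)(V) = Z·∫ 𝟙_S(g)·f(V^{g⁻¹}) dg`.**  Hypotheses: `W₀` bounded measurable with constant colour-orbit integral `Z` (`∫_c W₀(c·g) dc = Z`), `S` measurable and invariant under left colour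
multiplication, `W = S.indicator W₀` conjugation invariant, `f` bounded measurable and colour invariant. [cite: SeilerLNP1982, §2] [cite: Luscher1983, §3] -/
theorem localisedAvg_eq_const_mul_core {W₀ : (Site 3 L → SU2) → ℝ} (hW₀ : Measurable W₀) {CW : ℝ} (hCW : ∀ g, |W₀ g| ≤ CW) {Z : ℝ}
    (hZ : ∀ g : Site 3 L → SU2, ∫ c, W₀ (fun x => c * g x) ∂haarProbability SU2 = Z)
    {S : Set (Site 3 L → SU2)} (hSm : MeasurableSet S) (hS : ∀ (c : SU2) (g : Site 3 L → SU2), (fun x => c * g x) ∈ S ↔ g ∈ S)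
    (hWinv : ∀ (c : SU2) (g : Site 3 L → SU2), S.indicator W₀ (fun x => c * g x * c⁻¹) = S.indicator W₀ g)
    {f : GaugeConfig 3 L SU2 → ℝ} (hfm : Measurable f) {Cf : ℝ} (hCf : ∀ U, |f U| ≤ Cf) (hf : ∀ (c : SU2) (U : GaugeConfig 3 L SU2), f (gaugeTransform (fun _ : Site 3 L => c) U) = f U)
    (V : GaugeConfig 3 L SU2) :
    ∫ g, S.indicator W₀ g * f (gaugeTransform g⁻¹ V) ∂gaugeMeasure L = Z * ∫ g, S.indicator (fun g => f (gaugeTransform g⁻¹ V)) g ∂gaugeMeasure L := by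
  haveI : SecondCountableTopology SU2 := secondCountableTopology_su2
  haveI : IsProbabilityMeasure (gaugeMeasure L) := by unfold gaugeMeasure; infer_instance
  have hCf0 : 0 ≤ Cf := (abs_nonneg _).trans (hCf V)
  -- the colour FP identity applied to `F = 𝟙_S · f(·⁻¹ V)`
  have hFm : Measurable fun g : Site 3 L → SU2 => S.indicator (fun g => f (gaugeTransform g⁻¹ V)) g := by
    refine Measurable.indicator ?_ hSm
    have h := hfm.comp (measurable_gaugeAction_inv (L := L))
    have h2 : Measurable fun g : Site 3 L → SU2 => (V, g) := measurable_const.prodMk measurable_id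
    simpa only [Function.comp_def] using h.comp h2
  have hFb : ∀ g, |S.indicator (fun g => f (gaugeTransform g⁻¹ V)) g| ≤ Cf := fun g => by
    by_cases hg : g ∈ S
    · rw [Set.indicator_of_mem hg]; exact hCf _
    · rw [Set.indicator_of_notMem hg, abs_zero]; exact hCf0
  have hfp := integral_gaugeMeasure_fp hW₀ hCW hZ hFm hFb
  -- the inner integrals are all equal to `A_W(f)(V)`
  have hinner : ∀ c : SU2, ∫ g, S.indicator (fun g => f (gaugeTransform g⁻¹ V)) (fun x => c * g x) * W₀ g ∂gaugeMeasure L = ∫ g, S.indicator W₀ g * f (gaugeTransform g⁻¹ V) ∂gaugeMeasure L := by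
    intro c
    have h1 : ∫ g, S.indicator (fun g => f (gaugeTransform g⁻¹ V)) (fun x => c * g x) * W₀ g ∂gaugeMeasure L =
        ∫ g, S.indicator W₀ g * f (gaugeTransform g⁻¹ (gaugeTransform (fun _ : Site 3 L => c⁻¹) V)) ∂gaugeMeasure L := by
      refine integral_congr_ae (ae_of_all _ fun g => ?_)
      dsimp only
      by_cases hg : g ∈ S
      · rw [Set.indicator_of_mem ((hS c g).2 hg), Set.indicator_of_mem hg, gaugeTransform_constMul_inv, mul_comm]
      · rw [Set.indicator_of_notMem (fun h => hg ((hS c g).1 h)), Set.indicator_of_notMem hg, zero_mul, zero_mul]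
    rw [h1]
    exact localisedAvg_conj hWinv hf c⁻¹ V
  rw [funext hinner, integral_const] at hfp
  simp only [probReal_univ, smul_eq_mul, one_mul] at hfp
  exact hfp.symm

/-! ## §4 Sandwich by the full gauge average -/

/-- The core-restricted gauge average is at most the full one and at least the full one minus the core-complement part (`f ≥ 0`); the full one is `gaugeAvg f V` by inversion invariance. [folklore] -/
theorem core_gaugeAvg_sandwich {S : Set (Site 3 L → SU2)} (hSm : MeasurableSet S) {f : GaugeConfig 3 L SU2 → ℝ} (hfm : Measurable f) {Cf : ℝ} (hCf : ∀ U, |f U| ≤ Cf)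
    (hf0 : ∀ U, 0 ≤ f U) (V : GaugeConfig 3 L SU2) :
    ∫ g, S.indicator (fun g => f (gaugeTransform g⁻¹ V)) g ∂gaugeMeasure L ≤ gaugeAvg f V ∧
      gaugeAvg f V - ∫ g, Sᶜ.indicator (fun g => f (gaugeTransform g⁻¹ V)) g ∂gaugeMeasure L = ∫ g, S.indicator (fun g => f (gaugeTransform g⁻¹ V)) g ∂gaugeMeasure L := by
  haveI : SecondCountableTopology SU2 := secondCountableTopology_su2
  haveI : IsProbabilityMeasure (gaugeMeasure L) := by unfold gaugeMeasure; infer_instance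
  haveI : (gaugeMeasure L).IsInvInvariant := by unfold gaugeMeasure; infer_instance
  have hm : Measurable fun g : Site 3 L → SU2 => f (gaugeTransform g⁻¹ V) := by
    have h := hfm.comp (measurable_gaugeAction_inv (L := L))
    have h2 : Measurable fun g : Site 3 L → SU2 => (V, g) := measurable_const.prodMk measurable_id
    simpa only [Function.comp_def] using h.comp h2
  have hint : Integrable (fun g : Site 3 L → SU2 => f (gaugeTransform g⁻¹ V)) (gaugeMeasure L) := integrable_of_measurable_abs_le _ hm fun g => hCf _
  have hinv : gaugeAvg f V = ∫ g, f (gaugeTransform g⁻¹ V) ∂gaugeMeasure L := by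
    unfold gaugeAvg
    exact (integral_inv_eq_self (fun g : Site 3 L → SU2 => f (gaugeTransform g V)) (gaugeMeasure L)).symm
  have hsplit : ∫ g, f (gaugeTransform g⁻¹ V) ∂gaugeMeasure L = (∫ g, S.indicator (fun g => f (gaugeTransform g⁻¹ V)) g ∂gaugeMeasure L) +
      ∫ g, Sᶜ.indicator (fun g => f (gaugeTransform g⁻¹ V)) g ∂gaugeMeasure L := by
    rw [← integral_add (hint.indicator hSm) (hint.indicator hSm.compl)]
    refine integral_congr_ae (ae_of_all _ fun g => ?_)
    beta_reduce
    by_cases hg : g ∈ S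
    · rw [Set.indicator_of_mem hg, Set.indicator_of_notMem (Set.notMem_compl_iff.2 hg), add_zero]
    · rw [Set.indicator_of_notMem hg, Set.indicator_of_mem (Set.mem_compl hg), zero_add]
  have htail0 : 0 ≤ ∫ g, Sᶜ.indicator (fun g => f (gaugeTransform g⁻¹ V)) g ∂gaugeMeasure L := integral_nonneg fun g => Set.indicator_nonneg (fun _ _ => hf0 _) _
  rw [hinv, hsplit]
  constructor <;> linarith

/-- ★★ **Upper**: `A_W(f)(V) ≤ Z·gaugeAvg f V` (`f ≥ 0`, `Z ≥ 0`). [folklore] -/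
theorem localisedAvg_le_const_mul_gaugeAvg {W₀ : (Site 3 L → SU2) → ℝ} (hW₀ : Measurable W₀) {CW : ℝ} (hCW : ∀ g, |W₀ g| ≤ CW) {Z : ℝ} (hZ0 : 0 ≤ Z)
    (hZ : ∀ g : Site 3 L → SU2, ∫ c, W₀ (fun x => c * g x) ∂haarProbability SU2 = Z)
    {S : Set (Site 3 L → SU2)} (hSm : MeasurableSet S) (hS : ∀ (c : SU2) (g : Site 3 L → SU2), (fun x => c * g x) ∈ S ↔ g ∈ S)
    (hWinv : ∀ (c : SU2) (g : Site 3 L → SU2), S.indicator W₀ (fun x => c * g x * c⁻¹) = S.indicator W₀ g)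
    {f : GaugeConfig 3 L SU2 → ℝ} (hfm : Measurable f) {Cf : ℝ} (hCf : ∀ U, |f U| ≤ Cf) (hf0 : ∀ U, 0 ≤ f U)
    (hf : ∀ (c : SU2) (U : GaugeConfig 3 L SU2), f (gaugeTransform (fun _ : Site 3 L => c) U) = f U) (V : GaugeConfig 3 L SU2) :
    ∫ g, S.indicator W₀ g * f (gaugeTransform g⁻¹ V) ∂gaugeMeasure L ≤ Z * gaugeAvg f V := by
  rw [localisedAvg_eq_const_mul_core hW₀ hCW hZ hSm hS hWinv hfm hCf hf V]
  exact mul_le_mul_of_nonneg_left (core_gaugeAvg_sandwich hSm hfm hCf hf0 V).1 hZ0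

/-- ★★ **Lower**: `Z·(gaugeAvg f V − ∫ 𝟙_{Sᶜ}(g) f(V^{g⁻¹}) dg) ≤ A_W(f)(V)` (`Z ≥ 0`; in fact equality). [folklore] -/
theorem const_mul_gaugeAvg_sub_le_localisedAvg {W₀ : (Site 3 L → SU2) → ℝ} (hW₀ : Measurable W₀) {CW : ℝ} (hCW : ∀ g, |W₀ g| ≤ CW) {Z : ℝ}
    (hZ : ∀ g : Site 3 L → SU2, ∫ c, W₀ (fun x => c * g x) ∂haarProbability SU2 = Z)
    {S : Set (Site 3 L → SU2)} (hSm : MeasurableSet S) (hS : ∀ (c : SU2) (g : Site 3 L → SU2), (fun x => c * g x) ∈ S ↔ g ∈ S)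
    (hWinv : ∀ (c : SU2) (g : Site 3 L → SU2), S.indicator W₀ (fun x => c * g x * c⁻¹) = S.indicator W₀ g)
    {f : GaugeConfig 3 L SU2 → ℝ} (hfm : Measurable f) {Cf : ℝ} (hCf : ∀ U, |f U| ≤ Cf) (hf0 : ∀ U, 0 ≤ f U)
    (hf : ∀ (c : SU2) (U : GaugeConfig 3 L SU2), f (gaugeTransform (fun _ : Site 3 L => c) U) = f U) (V : GaugeConfig 3 L SU2) :
    Z * (gaugeAvg f V - ∫ g, Sᶜ.indicator (fun g => f (gaugeTransform g⁻¹ V)) g ∂gaugeMeasure L) = ∫ g, S.indicator W₀ g * f (gaugeTransform g⁻¹ V) ∂gaugeMeasure L := by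
  rw [localisedAvg_eq_const_mul_core hW₀ hCW hZ hSm hS hWinv hfm hCf hf V, (core_gaugeAvg_sandwich hSm hfm hCf hf0 V).2]

/-! ### The instance of record: `W = coreWeight ε R₁ = (coreSet R₁).indicator (fpWeight ε)` -/

omit [NeZero L] in
/-- The core set is invariant under left colour multiplication (jumps are computed from differences, which a left unit factor preserves in norm). [folklore] -/
theorem constMul_mem_coreSet_iff (R₁ : ℝ) (c : SU2) (g : Site 3 L → SU2) : (fun x => c * g x) ∈ coreSet L R₁ ↔ g ∈ coreSet L R₁ := by
  have hmul := @Literature.MathematicalPhysics.QuantumFieldTheory.Balaban1983to89.T4HaarSU2Translate.su2Quat_mul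
  have key : ∀ (d : SU2) (h : Site 3 L → SU2), h ∈ coreSet L R₁ → (fun x => d * h x) ∈ coreSet L R₁ := fun d h hh e => by
    have h1 : ‖su2Quat (h (e.1.shift e.2)) - su2Quat (h e.1)‖ < R₁ := hh e
    show ‖su2Quat (d * h (e.1.shift e.2)) - su2Quat (d * h e.1)‖ < R₁
    rw [hmul, hmul, ← mul_sub, norm_mul, norm_su2Quat, one_mul]
    exact h1
  refine ⟨fun h => ?_, key c g⟩
  have h2 := key c⁻¹ _ h
  simpa [← mul_assoc] using h2

/-- ★★ **The localised average of record**: for `W = coreWeight ε R₁` with the colour FP constant of `fpWeight ε` (hypothesis `hZ`, `…BTColourFP`) and a colour-invariant `0 ≤ f ≤ C_f`: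
`A_W(f)(V) = Z·∫ 𝟙_{coreSet R₁}(g)·f(V^{g⁻¹}) dg`, `A_W(f)(V) ≤ Z·gaugeAvg f V`, and `Z·(gaugeAvg f V − ∫ 𝟙_{(coreSet R₁)ᶜ}(g)·f(V^{g⁻¹}) dg) = A_W(f)(V)`. [cite: Luscher1983, §3] -/
theorem localisedAvg_coreWeight (ε R₁ : ℝ) {Z : ℝ} (hZ0 : 0 ≤ Z) (hZ : ∀ g : Site 3 L → SU2, ∫ c, fpWeight L ε (fun x => c * g x) ∂haarProbability SU2 = Z)
    {f : GaugeConfig 3 L SU2 → ℝ} (hfm : Measurable f) {Cf : ℝ} (hCf : ∀ U, |f U| ≤ Cf) (hf0 : ∀ U, 0 ≤ f U)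
    (hf : ∀ (c : SU2) (U : GaugeConfig 3 L SU2), f (gaugeTransform (fun _ : Site 3 L => c) U) = f U) (V : GaugeConfig 3 L SU2) :
    ∫ g, coreWeight L ε R₁ g * f (gaugeTransform g⁻¹ V) ∂gaugeMeasure L = Z * ∫ g, (coreSet L R₁).indicator (fun g => f (gaugeTransform g⁻¹ V)) g ∂gaugeMeasure L ∧
      ∫ g, coreWeight L ε R₁ g * f (gaugeTransform g⁻¹ V) ∂gaugeMeasure L ≤ Z * gaugeAvg f V ∧
      Z * (gaugeAvg f V - ∫ g, (coreSet L R₁)ᶜ.indicator (fun g => f (gaugeTransform g⁻¹ V)) g ∂gaugeMeasure L) = ∫ g, coreWeight L ε R₁ g * f (gaugeTransform g⁻¹ V) ∂gaugeMeasure L := by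
  have hW₀ := measurable_fpWeight (L := L) ε
  have hCW : ∀ g, |fpWeight L ε g| ≤ 1 := abs_fpWeight_le (L := L) ε
  have hSm := measurableSet_coreSet (L := L) R₁
  have hS := constMul_mem_coreSet_iff (L := L) R₁
  have hWinv : ∀ (c : SU2) (g : Site 3 L → SU2), (coreSet L R₁).indicator (fpWeight L ε) (fun x => c * g x * c⁻¹) = (coreSet L R₁).indicator (fpWeight L ε) g :=
    coreWeight_conj ε R₁
  exact ⟨localisedAvg_eq_const_mul_core hW₀ hCW hZ hSm hS hWinv hfm hCf hf V, localisedAvg_le_const_mul_gaugeAvg hW₀ hCW hZ0 hZ hSm hS hWinv hfm hCf hf0 hf V,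
    const_mul_gaugeAvg_sub_le_localisedAvg hW₀ hCW hZ hSm hS hWinv hfm hCf hf0 hf V⟩

end Summit.QuantumFields.YangMills.Theorems.FemtoTransferGap.TwoLattice.ConstTube

end
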